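import Literature.Analysis.FunctionSpaces.PVToolkitBounded
import HarnessLib

/-!
# A toolkit of `PV`-definable functions, III: curried forms, division with remainder, powers

Topic `Literature/Analysis/FunctionSpaces`, continuing `PVToolkit.lean` / `PVToolkitBounded.lean`
(semantic closure properties of Cobham's class `IsPVDefinable`).  This file adds the plumbing used when
a long polynomial-time construction (the Dinur gap-amplification map of the PCP theorem, rendered as a
function on numbers) is assembled from unary/binary/ternary number-theoretic functions:

* curried forms `PV₁ f`, `PV₂ f`, `PV₃ f`, `PV₄ f` of definability for `f : ℕ → ℕ`, `ℕ → ℕ → ℕ`, …,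
  with the substitution lemmas `PV₁.comp`, `PV₂.comp`, … (`x ↦ f (F x) (G x)` is definable when
  `f`, `F`, `G` are), `PV₂.left/right`, and the basic instances `PV₁.id/const`, `PV₂.add/mul/sub`;
* **division with remainder** (`IsPVDefinable.mod`, `IsPVDefinable.div`; Cook 1975, §2 lists them
  among the first derived functions of `PV`): long division by recursion on the notation of the
  dividend, `r(2y+b) = (2 r(y) + b) [- d]`, `q(2y+b) = 2 q(y) + [2 r(y) + b ≥ d]`, with the
  conventions `a % 0 = a`, `a / 0 = 0` of `ℕ`;
* bounded powers `F ^ min (G) |S|` (`IsPVDefinable.powLen`), in particular `c ^ |S|`-bounded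
  exponentials of constants and `F ^ G` under a hypothesis `G ≤ |S|`.

## References

* S. A. Cook, *Feasibly constructive proofs and the propositional calculus*, STOC 1975, §2.
* A. Cobham, *The intrinsic computational difficulty of functions*, 1965.
* S. R. Buss, *Bounded Arithmetic*, Bibliopolis 1986, Ch. 1.
-/

namespace Literature.Analysis.FunctionSpaces

open PVFun

variable {n : ℕ}

/-! ## Curried forms -/

/-- `f : ℕ → ℕ` is in Cobham's class. [cite: Cobham1965] -/
abbrev PV₁ (f : ℕ → ℕ) : Prop := IsPVDefinable fun v : Fin 1 → ℕ => f (v 0)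

/-- `f : ℕ → ℕ → ℕ` is in Cobham's class. [cite: Cobham1965] -/
abbrev PV₂ (f : ℕ → ℕ → ℕ) : Prop := IsPVDefinable fun v : Fin 2 → ℕ => f (v 0) (v 1)

/-- `f : ℕ → ℕ → ℕ → ℕ` is in Cobham's class. [cite: Cobham1965] -/
abbrev PV₃ (f : ℕ → ℕ → ℕ → ℕ) : Prop := IsPVDefinable fun v : Fin 3 → ℕ => f (v 0) (v 1) (v 2)

/-- `f : ℕ → ℕ → ℕ → ℕ → ℕ` is in Cobham's class. [cite: Cobham1965] -/
abbrev PV₄ (f : ℕ → ℕ → ℕ → ℕ → ℕ) : Prop := IsPVDefinable fun v : Fin 4 → ℕ => f (v 0) (v 1) (v 2) (v 3)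

/-- Substituting definable functions into a definable unary function. [cite: Cobham1965] -/
theorem PV₁.comp {f : ℕ → ℕ} (hf : PV₁ f) {F : (Fin n → ℕ) → ℕ} (hF : IsPVDefinable F) : IsPVDefinable fun x => f (F x) :=
  hf.compVec (w := fun x _ => F x) fun _ => hF

/-- Substituting into a definable binary function. [cite: Cobham1965] -/
theorem PV₂.comp {f : ℕ → ℕ → ℕ} (hf : PV₂ f) {F G : (Fin n → ℕ) → ℕ} (hF : IsPVDefinable F) (hG : IsPVDefinable G) :
    IsPVDefinable fun x => f (F x) (G x) :=
  hf.compVec (w := fun x => ![F x, G x]) fun i => by fin_cases i <;> simpa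

/-- Substituting into a definable ternary function. [cite: Cobham1965] -/
theorem PV₃.comp {f : ℕ → ℕ → ℕ → ℕ} (hf : PV₃ f) {F G H : (Fin n → ℕ) → ℕ} (hF : IsPVDefinable F) (hG : IsPVDefinable G)
    (hH : IsPVDefinable H) : IsPVDefinable fun x => f (F x) (G x) (H x) :=
  hf.compVec (w := fun x => ![F x, G x, H x]) fun i => by fin_cases i <;> simpa

/-- Substituting into a definable quaternary function. [cite: Cobham1965] -/
theorem PV₄.comp {f : ℕ → ℕ → ℕ → ℕ → ℕ} (hf : PV₄ f) {F G H K : (Fin n → ℕ) → ℕ} (hF : IsPVDefinable F) (hG : IsPVDefinable G)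
    (hH : IsPVDefinable H) (hK : IsPVDefinable K) : IsPVDefinable fun x => f (F x) (G x) (H x) (K x) :=
  hf.compVec (w := fun x => ![F x, G x, H x, K x]) fun i => by fin_cases i <;> simpa

/-- A unary function of a unary function. [cite: Cobham1965] -/
theorem PV₁.comp₁ {f g : ℕ → ℕ} (hf : PV₁ f) (hg : PV₁ g) : PV₁ fun a => f (g a) := hf.comp hg

/-- Extensionality for `PV₁`. [folklore] -/
theorem PV₁.of_eq {f g : ℕ → ℕ} (hf : PV₁ f) (h : ∀ a, f a = g a) : PV₁ g := IsPVDefinable.of_eq hf fun _ => h _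

/-- Extensionality for `PV₂`. [folklore] -/
theorem PV₂.of_eq {f g : ℕ → ℕ → ℕ} (hf : PV₂ f) (h : ∀ a b, f a b = g a b) : PV₂ g := IsPVDefinable.of_eq hf fun _ => h _ _

/-- Extensionality for `PV₃`. [folklore] -/
theorem PV₃.of_eq {f g : ℕ → ℕ → ℕ → ℕ} (hf : PV₃ f) (h : ∀ a b c, f a b c = g a b c) : PV₃ g := IsPVDefinable.of_eq hf fun _ => h _ _ _

/-- The identity. [cite: Cobham1965] -/
theorem PV₁.id : PV₁ fun a => a := IsPVDefinable.proj 0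

/-- Constants. [cite: Cobham1965] -/
theorem PV₁.const (c : ℕ) : PV₁ fun _ => c := IsPVDefinable.const c

/-- Addition. [cite: Buss1986, Ch. 1] -/
theorem PV₂.add : PV₂ fun a b => a + b := (IsPVDefinable.proj 0).add (IsPVDefinable.proj 1)

/-- Multiplication. [cite: Buss1986, Ch. 1] -/
theorem PV₂.mul : PV₂ fun a b => a * b := (IsPVDefinable.proj 0).mul (IsPVDefinable.proj 1)

/-- Truncated subtraction. [cite: Cook1975, §2] -/
theorem PV₂.sub : PV₂ fun a b => a - b := (IsPVDefinable.proj 0).sub (IsPVDefinable.proj 1)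

/-- Fixing the first argument of a binary function at a definable value. [folklore] -/
theorem PV₂.left {f : ℕ → ℕ → ℕ} (hf : PV₂ f) (c : ℕ) : PV₁ fun b => f c b := hf.comp (IsPVDefinable.const c) (IsPVDefinable.proj 0)

/-- Fixing the second argument. [folklore] -/
theorem PV₂.right {f : ℕ → ℕ → ℕ} (hf : PV₂ f) (c : ℕ) : PV₁ fun a => f a c := hf.comp (IsPVDefinable.proj 0) (IsPVDefinable.const c)

/-! ## Division with remainder -/

section DivMod

/-- One step of long division on the remainder: `r' = 2r + b`, reduced once by `d`. [cite: Cook1975, §2] -/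
def modStep (b : Bool) (d r : ℕ) : ℕ := if 2 * r + b.toNat < d then 2 * r + b.toNat else 2 * r + b.toNat - d

/-- The remainder recursion: `(2y + b) % d = modStep b d (y % d)`. [folklore] -/
theorem bit_mod (b : Bool) (y d : ℕ) : Nat.bit b y % d = modStep b d (y % d) := by
  unfold modStep
  rcases Nat.eq_zero_or_pos d with rfl | hd
  · simp [Nat.bit_val]
  · have hlt : 2 * (y % d) + b.toNat < 2 * d := by have := Nat.mod_lt y hd; cases b <;> simp <;> omega
    have hcong : Nat.bit b y % d = (2 * (y % d) + b.toNat) % d := by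
      rw [Nat.bit_val]
      have e : 2 * y + b.toNat = 2 * (y % d) + b.toNat + 2 * d * (y / d) := by
        have := Nat.div_add_mod y d; nlinarith [this]
      rw [e, show 2 * d * (y / d) = d * (2 * (y / d)) by ring, Nat.add_mul_mod_self_left]
    rw [hcong]
    split_ifs with h
    · exact Nat.mod_eq_of_lt h
    · rw [Nat.mod_eq_sub_mod (not_lt.1 h), Nat.mod_eq_of_lt (by omega)]

/-- The remainder by recursion on notation of the dividend. [cite: Cook1975, §2] -/
theorem recN_mod (x : Fin 1 → ℕ) (a : ℕ) :
    recN (fun _ => 0) (fun b x _ r => modStep b (x 0) r) (fun _ y => y) x a = a % x 0 := by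
  induction a using Nat.binaryRec' with
  | zero => simp
  | bit b y hy ih =>
    rw [recN_bit _ _ _ _ _ _ hy, ih, ← bit_mod]
    exact min_eq_left (Nat.mod_le _ _)

/-- **The remainder is in Cobham's class** (`a % 0 = a`). [cite: Cook1975, §2] -/
theorem PV₂.mod : PV₂ fun a d => a % d := by
  -- as a function of the vector `(d, a)`: recursion on the last argument
  have hstep : ∀ b, IsPVDefinable fun v : Fin 3 → ℕ => modStep b ((Fin.init (Fin.init v) : Fin 1 → ℕ) 0) (v (Fin.last 2)) := by
    intro b
    have hr : IsPVDefinable fun v : Fin 3 → ℕ => 2 * v (Fin.last 2) + b.toNat :=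
      ((IsPVDefinable.const 2).mul (IsPVDefinable.proj (Fin.last 2))).add (IsPVDefinable.const _)
    have hd : IsPVDefinable fun v : Fin 3 → ℕ => (Fin.init (Fin.init v) : Fin 1 → ℕ) 0 := IsPVDefinable.init_init_coord 0
    exact (hr.ite_lt hd hr (hr.sub hd)).of_eq fun v => by unfold modStep; rfl
  have h := IsPVDefinable.of_recN (n := 1) (base := fun _ => 0) (step := fun b x _ r => modStep b (x 0) r) (bound := fun _ y => y)
    (IsPVDefinable.const 0) hstep (IsPVDefinable.proj (Fin.last 1))
  have h2 : IsPVDefinable fun v : Fin 2 → ℕ => v 1 % v 0 :=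
    h.of_eq fun v => by rw [recN_mod]; rfl
  exact h2.compVec (w := fun v => ![v 1, v 0]) fun i => by fin_cases i <;> simpa using IsPVDefinable.proj _

/-- The remainder of definable functions. [cite: Cook1975, §2] -/
theorem IsPVDefinable.mod {F G : (Fin n → ℕ) → ℕ} (hF : IsPVDefinable F) (hG : IsPVDefinable G) :
    IsPVDefinable fun x => F x % G x := PV₂.mod.comp hF hG

/-- One step of long division on the quotient: `q' = 2q + [2 r + b ≥ d]`. [cite: Cook1975, §2] -/
def divStep (b : Bool) (d r q : ℕ) : ℕ := if 2 * r + b.toNat < d then 2 * q else 2 * q + 1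

/-- The quotient recursion: `(2y + b) / d = divStep b d (y % d) (y / d)` for `d > 0`. [folklore] -/
theorem bit_div (b : Bool) (y : ℕ) {d : ℕ} (hd : 0 < d) : Nat.bit b y / d = divStep b d (y % d) (y / d) := by
  unfold divStep
  have hdec : Nat.bit b y = d * (2 * (y / d)) + (2 * (y % d) + b.toNat) := by
    rw [Nat.bit_val]; have := Nat.div_add_mod y d; cases b <;> simp <;> nlinarith [this]
  have hlt : 2 * (y % d) + b.toNat < 2 * d := by have := Nat.mod_lt y hd; cases b <;> simp <;> omega
  rw [hdec, Nat.mul_add_div hd]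
  split_ifs with h
  · rw [Nat.div_eq_of_lt h, add_zero]
  · congr 1
    rw [Nat.div_eq_sub_div hd (not_lt.1 h), Nat.div_eq_of_lt (by omega)]

/-- The quotient by recursion on notation of the dividend (for `d > 0`). [cite: Cook1975, §2] -/
theorem recN_div (x : Fin 1 → ℕ) (hx : 0 < x 0) (a : ℕ) :
    recN (fun _ => 0) (fun b x y q => divStep b (x 0) (y % x 0) q) (fun _ y => y) x a = a / x 0 := by
  induction a using Nat.binaryRec' with
  | zero => simp
  | bit b y hy ih =>
    rw [recN_bit _ _ _ _ _ _ hy, ih, ← bit_div b y hx]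
    exact min_eq_left (Nat.div_le_self _ _)

/-- **The quotient is in Cobham's class** (`a / 0 = 0`). [cite: Cook1975, §2] -/
theorem PV₂.div : PV₂ fun a d => a / d := by
  have hstep : ∀ b, IsPVDefinable fun v : Fin 3 → ℕ =>
      divStep b ((Fin.init (Fin.init v) : Fin 1 → ℕ) 0) (v (Fin.last 1).castSucc % (Fin.init (Fin.init v) : Fin 1 → ℕ) 0) (v (Fin.last 2)) := by
    intro b
    have hd : IsPVDefinable fun v : Fin 3 → ℕ => (Fin.init (Fin.init v) : Fin 1 → ℕ) 0 := IsPVDefinable.init_init_coord 0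
    have hy : IsPVDefinable fun v : Fin 3 → ℕ => v (Fin.last 1).castSucc := IsPVDefinable.proj _
    have hr : IsPVDefinable fun v : Fin 3 → ℕ => 2 * (v (Fin.last 1).castSucc % (Fin.init (Fin.init v) : Fin 1 → ℕ) 0) + b.toNat :=
      ((IsPVDefinable.const 2).mul (hy.mod hd)).add (IsPVDefinable.const _)
    have hq : IsPVDefinable fun v : Fin 3 → ℕ => 2 * v (Fin.last 2) := (IsPVDefinable.const 2).mul (IsPVDefinable.proj _)
    exact (hr.ite_lt hd hq hq.succ).of_eq fun v => by unfold divStep; rfl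
  have h := IsPVDefinable.of_recN (n := 1) (base := fun _ => 0) (step := fun b x y q => divStep b (x 0) (y % x 0) q) (bound := fun _ y => y)
    (IsPVDefinable.const 0) hstep (IsPVDefinable.proj (Fin.last 1))
  -- guard `d = 0`
  have h2 : IsPVDefinable fun v : Fin 2 → ℕ => v 1 / v 0 := by
    refine ((IsPVDefinable.proj 0).cond (IsPVDefinable.const 0) h).of_eq fun v => ?_
    rcases Nat.eq_zero_or_pos (v 0) with h0 | hpos
    · simp [h0]
    · rw [if_neg hpos.ne']
      have := recN_div (Fin.init v) hpos (v (Fin.last 1))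
      exact this
  exact h2.compVec (w := fun v => ![v 1, v 0]) fun i => by fin_cases i <;> simpa using IsPVDefinable.proj _

/-- The quotient of definable functions. [cite: Cook1975, §2] -/
theorem IsPVDefinable.div {F G : (Fin n → ℕ) → ℕ} (hF : IsPVDefinable F) (hG : IsPVDefinable G) :
    IsPVDefinable fun x => F x / G x := PV₂.div.comp hF hG

end DivMod

/-! ## Bounded powers -/

section Pow

/-- Powers by recursion on the notation of a ruler: after `|r|` steps the accumulator is
`c ^ min e |r|`, bounded by `2^{|c|·|r|}·1`. [folklore] -/
theorem recN_pow (x : Fin 2 → ℕ) (r : ℕ) :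
    recN (fun _ => 1) (fun _ x y acc => if y.size < x 1 then acc * x 0 else acc)
      (fun x y => 2 ^ (Nat.size (x 0) * Nat.size y)) x r = x 0 ^ min (x 1) r.size := by
  induction r using Nat.binaryRec' with
  | zero => simp
  | bit b y hy ih =>
    rw [recN_bit _ _ _ _ _ _ hy, ih, size_bit_of_imp hy]
    have hb : ∀ k : ℕ, x 0 ^ k ≤ 2 ^ (Nat.size (x 0) * k) := fun k => by
      rw [pow_mul]; exact Nat.pow_le_pow_left (Nat.lt_size_self _).le k
    split_ifs with h
    · rw [min_eq_right h.le, min_eq_right (Nat.succ_le_of_lt h), ← pow_succ]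
      exact min_eq_left ((hb _).trans (Nat.pow_le_pow_right two_pos (Nat.mul_le_mul_left _ le_rfl)))
    · rw [not_lt] at h
      rw [min_eq_left h, min_eq_left (h.trans (Nat.le_succ _))]
      exact min_eq_left ((hb _).trans (Nat.pow_le_pow_right two_pos (Nat.mul_le_mul_left _ (h.trans (Nat.le_succ _)))))

/-- **Bounded exponentiation**: `x ↦ F x ^ min (G x) |S x|` is in Cobham's class. [cite: Buss1986, Ch. 1] -/
theorem IsPVDefinable.powLen {F G S : (Fin n → ℕ) → ℕ} (hF : IsPVDefinable F) (hG : IsPVDefinable G) (hS : IsPVDefinable S) :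
    IsPVDefinable fun x => F x ^ min (G x) (S x).size := by
  have hstep : ∀ b : Bool, IsPVDefinable fun v : Fin 4 → ℕ =>
      if (v (Fin.last 2).castSucc).size < (Fin.init (Fin.init v) : Fin 2 → ℕ) 1 then v (Fin.last 3) * (Fin.init (Fin.init v) : Fin 2 → ℕ) 0
      else v (Fin.last 3) := by
    intro b
    exact ((IsPVDefinable.proj _).len.ite_lt (IsPVDefinable.init_init_coord 1)
      ((IsPVDefinable.proj _).mul (IsPVDefinable.init_init_coord 0)) (IsPVDefinable.proj _))
  have hbound : IsPVDefinable fun v : Fin 3 → ℕ => 2 ^ (Nat.size ((Fin.init v : Fin 2 → ℕ) 0) * Nat.size (v (Fin.last 2))) :=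
    (IsPVDefinable.init_coord 0).smash (IsPVDefinable.proj _)
  have h := IsPVDefinable.of_recN (n := 2) (base := fun _ => 1)
    (step := fun _ x y acc => if y.size < x 1 then acc * x 0 else acc)
    (bound := fun x y => 2 ^ (Nat.size (x 0) * Nat.size y)) (IsPVDefinable.const 1) hstep hbound
  have h3 : PV₃ fun c e r => c ^ min e r.size := h.of_eq fun v => by rw [recN_pow]; rfl
  exact h3.comp hF hG hS

/-- Powers with an exponent bounded by a length: if `G x ≤ |S x|` then `x ↦ F x ^ G x` is definable. [cite: Buss1986, Ch. 1] -/
theorem IsPVDefinable.pow_of_le {F G S : (Fin n → ℕ) → ℕ} (hF : IsPVDefinable F) (hG : IsPVDefinable G) (hS : IsPVDefinable S)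
    (hle : ∀ x, G x ≤ (S x).size) : IsPVDefinable fun x => F x ^ G x :=
  (hF.powLen hG hS).of_eq fun x => by rw [min_eq_left (hle x)]

/-- Powers of `2` with an exponent bounded by a length. [cite: Buss1986, Ch. 1] -/
theorem IsPVDefinable.two_pow_of_le {G S : (Fin n → ℕ) → ℕ} (hG : IsPVDefinable G) (hS : IsPVDefinable S)
    (hle : ∀ x, G x ≤ (S x).size) : IsPVDefinable fun x => 2 ^ G x :=
  (IsPVDefinable.const 2).pow_of_le hG hS hle

end Pow

end Literature.Analysis.FunctionSpaces
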